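import Literature.Computability.Complexity.GateEliminationSubst

/-!
# Gate elimination, XIX: affine substitutions on rdq-sources

Source side of the affine substitutions of Li–Yang (STOC 2022; full version ECCC TR21-023,
§2.4 "Affine substitution: let `x_j` be an unprotected free variable and `x_k` be a free
variable. We can substitute `x_j ← x_k ⊕ c₁` … `x_j` becomes an affine variable with the equation
`x_j = x_k ⊕ c₁`", and §2.6 "Constant substitution to gate: … we further restrict `R` to `R'` by
making `x_i` a linear variable with proper affine equation"), generalizing
`RdqSource.assignFree` of `GateEliminationSubst.lean` from a constant to any affine expression
`E` in free or quadratic variables other than `x_j`. Everything is PROVED.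

* `RdqSource.assignLin R j E` — `x_j` becomes linear with equation `x_j = E`, its occurrences in
  affine equations are unfolded (`LinEq.substVar`); quadratic equations unchanged (`x_j`
  unprotected).
* `free_assignLin_iff`, `dim_assignLin` (`dim' + 1 = dim`), `quadCount_assignLin`,
  `protected_assignLin_iff`, `mem_sol_assignLin_iff` / `sol_assignLin`
  (`Sol' = Sol ∩ {x_j = E}`).

The circuit side (rewiring the readers of `x_j` to `x_k` with the functions adjusted, and the
xor-reconstruction of Prop. 2.8) is not here yet.

## References

* J. Li, T. Yang, *3.1n − o(n) circuit lower bounds for explicit functions*, STOC 2022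
  [LiYang2022]; full version ECCC TR21-023, §2.4, §2.6, Prop. 2.6.
-/

namespace Literature.Computability.Complexity

open Finset

namespace RdqSource

variable {n : ℕ} (R : RdqSource n)

/-- The rdq-source after the **affine substitution `x_j := E`** to an unprotected free variable
`x_j`, where `E` is an affine expression in free or quadratic variables other than `x_j`
(Li–Yang §2.4 "Affine substitution": `x_j ← x_k ⊕ c`, "`x_j` becomes an affine variable with the
equation `x_j = x_k ⊕ c`"; and §2.6 "Constant substitution to gate": "we further restrict `R` to
`R'` by making `x_i` a linear variable with proper affine equation"). The constant substitution
`assignFree` is the case `E = const b`. [cite: LiYang2022, §2.4, §2.6] -/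
def assignLin (j : Fin n) (E : LinEq n) (hj : R.Free j) (hjp : ¬ R.Protected j)
    (hE : ∀ i ∈ E.support, R.lin i = none ∧ i ≠ j) : RdqSource n where
  lin i := if i = j then some E else (R.lin i).map fun E₀ => E₀.substVar j E
  quad := R.quad
  lin_or_quad i := by
    by_cases h : i = j
    · exact Or.inr (h ▸ hj.2)
    · rcases R.lin_or_quad i with h' | h'
      · exact Or.inl (by simp [h, h'])
      · exact Or.inr h'
  lin_wf i E' h i' hi' := by
    by_cases hi : i = j
    · subst hi
      simp only [if_true, Option.some.injEq] at h
      subst h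
      obtain ⟨h1, h2⟩ := hE i' hi'
      simp [h2, h1]
    · simp only [hi, if_false] at h
      obtain ⟨E₀, hE₀, rfl⟩ := Option.map_eq_some_iff.mp h
      rcases LinEq.mem_support_substVar hi' with ⟨hmem, hne⟩ | hmem
      · simp [hne, R.lin_wf i E₀ hE₀ i' hmem]
      · obtain ⟨h1, h2⟩ := hE i' hmem
        simp [h2, h1]
  quad_wf i e h := by
    have hw := R.quad_wf i e h
    have hij : e.i ≠ j := fun h' => hjp (protected_of_reads h (Or.inl h'))
    have hkj : e.k ≠ j := fun h' => hjp (protected_of_reads h (Or.inr h'))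
    simp [hij, hkj, hw.1.1, hw.1.2, hw.2.1.1, hw.2.1.2, hw.2.2]
  read_once := R.read_once

section AssignLin

variable {R}
variable {j : Fin n} {E : LinEq n} (hj : R.Free j) (hjp : ¬ R.Protected j)
  (hE : ∀ i ∈ E.support, R.lin i = none ∧ i ≠ j)

/-- Affine equations after `assignLin`. [folklore] -/
theorem assignLin_lin (i : Fin n) :
    (R.assignLin j E hj hjp hE).lin i = if i = j then some E else (R.lin i).map fun E₀ => E₀.substVar j E := rfl

/-- Quadratic equations are unchanged. [folklore] -/
@[simp] theorem assignLin_quad : (R.assignLin j E hj hjp hE).quad = R.quad := rfl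

/-- Free variables after `assignLin`: all but `x_j`. [cite: LiYang2022, §2.4] -/
theorem free_assignLin_iff (i : Fin n) : (R.assignLin j E hj hjp hE).Free i ↔ R.Free i ∧ i ≠ j := by
  unfold Free
  rw [assignLin_lin, assignLin_quad]
  by_cases hi : i = j
  · subst hi; simp
  · simp [hi]

/-- **`assignLin` lowers the dimension by one.** [cite: LiYang2022, §2.4] -/
theorem dim_assignLin : (R.assignLin j E hj hjp hE).dim + 1 = R.dim := by
  unfold dim
  have h1 : (univ.filter fun i => (R.assignLin j E hj hjp hE).Free i) = (univ.filter fun i => R.Free i).erase j := by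
    ext i
    simp only [mem_filter, mem_univ, true_and, mem_erase, free_assignLin_iff]
    tauto
  rw [h1, card_erase_add_one]
  simpa using hj

/-- `assignLin` keeps the number of quadratic equations. [folklore] -/
@[simp] theorem quadCount_assignLin : (R.assignLin j E hj hjp hE).quadCount = R.quadCount := rfl

/-- `assignLin` keeps the protected variables. [folklore] -/
theorem protected_assignLin_iff (i : Fin n) : (R.assignLin j E hj hjp hE).Protected i ↔ R.Protected i := by
  unfold Protected
  rw [free_assignLin_iff, assignLin_quad]
  constructor
  · rintro ⟨⟨hf, -⟩, h⟩; exact ⟨hf, h⟩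
  · rintro ⟨hf, l, e, h, hr⟩
    exact ⟨⟨hf, fun hij => hjp (hij ▸ ⟨hf, l, e, h, hr⟩)⟩, l, e, h, hr⟩

/-- **Solutions after `assignLin`**: the old solutions with `x_j = E`. [cite: LiYang2022, §2.4, Prop. 2.6] -/
theorem mem_sol_assignLin_iff (v : Fin n → ZMod 2) :
    v ∈ (R.assignLin j E hj hjp hE).Sol ↔ v ∈ R.Sol ∧ v j = E.eval v := by
  have hjE : j ∉ E.support := fun h => (hE j h).2 rfl
  rw [mem_sol_iff, mem_sol_iff]
  simp only [assignLin_lin, assignLin_quad]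
  constructor
  · rintro ⟨hlin, hquad⟩
    have hvj : v j = E.eval v := hlin j E (by simp)
    refine ⟨⟨fun i E₀ hi => ?_, hquad⟩, hvj⟩
    have hij : i ≠ j := fun h => by rw [h, hj.1] at hi; exact Option.some_ne_none _ hi.symm
    have := hlin i (E₀.substVar j E) (by simp [hij, hi])
    rwa [LinEq.eval_substVar _ _ hvj] at this
  · rintro ⟨⟨hlin, hquad⟩, hvj⟩
    refine ⟨fun i E₀ hi => ?_, hquad⟩
    by_cases hij : i = j
    · subst hij
      simp only [if_true, Option.some.injEq] at hi
      rw [← hi]; exact hvj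
    · simp only [hij, if_false] at hi
      obtain ⟨E₁, hE₁, rfl⟩ := Option.map_eq_some_iff.mp hi
      rw [LinEq.eval_substVar _ _ hvj]
      exact hlin i E₁ hE₁

/-- Solutions after `assignLin`, as a set. [cite: LiYang2022, §2.4] -/
theorem sol_assignLin : (R.assignLin j E hj hjp hE).Sol = R.Sol ∩ {v | v j = E.eval v} :=
  Set.ext fun v => mem_sol_assignLin_iff hj hjp hE v

end AssignLin

end RdqSource

end Literature.Computability.Complexity
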